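import Literature.AlgebraicGeometry.Limits.SmoothProjectiveIntegralModel
import Literature.RingTheory.Localization.FiniteTypeSubringDescent
import Mathlib.Algebra.Category.Ring.Constructions
import Mathlib.RingTheory.Localization.BaseChange
import HarnessLib

/-!
# A smooth affine variety has a smooth affine model over a finitely generated subring

Topic `Literature/AlgebraicGeometry/Limits` (EGA IV₃ §8 "spreading out"; companion of
`SmoothProjectiveIntegralModel`, which treats smooth PROJECTIVE varieties). **For an integral affine
scheme `S` smooth of relative dimension `d` over a field `K` there are a ring `R` of finite type over
`ℤ` with a ring map `R → K` (recorded as `Algebra R K`; the construction gives `R = R₀[1/s]` for a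
finitely generated subring `R₀ ⊆ K`, but injectivity of `R → K` is NOT part of the statement — the
consumer `HodgeTheory.exists_wittVector_points_same_reduction_generic` does not need it), an
`R`-algebra `B` of finite type with `Spec B → Spec R` smooth of relative dimension `d`, and a
cartesian square exhibiting `S → Spec K` as the base change of `Spec B → Spec R` along
`Spec K → Spec R`** (`exists_smooth_affine_model_finiteType_int`). This is the spreading-out datum of the `p`-adic
disc argument (Maulik–Poonen 2012, §4) for the BASE CURVE of a family, in the shape consumed by
`HodgeTheory.exists_wittVector_points_same_reduction_generic`.

Proof: `Γ(S) = K ⊗_{R₀} C₀` for a finitely generated subring `R₀ ⊆ K` and a finitely generated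
domain `C₀ ⊇ R₀` (`Localization.exists_fg_subalgebra_tensorProduct_algEquiv`); the generic fibre
`Spec (Frac R₀ ⊗ C₀)` is smooth by fpqc descent from `Spec (K ⊗ C₀) = S`; so `Spec C₀` is smooth
over `R = R₀[1/s]` for some `s ≠ 0` (`LocApprox.exists_forall_smooth_snd`, EGA IV₄ 17.7.8); the
model `B = R ⊗_{R₀} C₀ = C₀[1/s]` is a domain, so `Spec B → Spec R` is smooth of ONE relative
dimension, which is `d` by comparison with `S`.

* `isPullback_of_tensorProduct_algEquiv` — packaging: an isomorphism `K ⊗_R B ≃ₐ[K] Γ(S)` of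
  `K`-algebras makes the affine `K`-scheme `S` the base change of `Spec B → Spec R`;
* `exists_smooth_affine_model_finiteType_int` — the statement.

## References

* [EGAIV3] A. Grothendieck, J. Dieudonné, EGA IV₃, Thm. 8.8.2 (ii), Thm. 8.10.5.
* [EGAIV4] EGA IV₄, Prop. 17.7.8 (ii).
* [MaulikPoonen2012] D. Maulik, B. Poonen, Néron–Severi groups under specialization, Duke Math.
  J. 161 (2012), §4.
* [Hartshorne1977] R. Hartshorne, Algebraic Geometry (1977), II Prop. 2.3, II Thm. 3.3.
-/

noncomputable section

universe u

open CategoryTheory CategoryTheory.Limits AlgebraicGeometry TensorProduct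
open Literature.AlgebraicGeometry.Motives

namespace Literature.AlgebraicGeometry.Limits

/-! ## The `K`-algebra of global sections of an affine `K`-scheme -/

section Sections

variable {K : Type u} [CommRing K] (S : SchemeOver K) [IsAffine S.left]

/-- For an affine `K`-scheme, `S → Spec K` is `S ≅ Spec Γ(S) → Spec K`, the second map induced by
the structure map `K → Γ(S)` (Mathlib `Scheme.toSpecΓ_naturality`). [cite: Hartshorne1977, Ch. II Prop. 2.3] -/
theorem isoSpec_hom_comp_specMap_secAlgebraMap :
    S.left.isoSpec.hom ≫ Spec.map (CommRingCat.ofHom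
      (S.hom.appTop.hom.comp (Scheme.ΓSpecIso (CommRingCat.of K)).inv.hom)) = S.hom := by
  rw [CommRingCat.ofHom_comp, CommRingCat.ofHom_hom, CommRingCat.ofHom_hom, Spec.map_comp]
  change S.left.toSpecΓ ≫ Spec.map S.hom.appTop ≫ Spec.map (Scheme.ΓSpecIso (CommRingCat.of K)).inv =
    S.hom
  rw [← Category.assoc, ← Scheme.toSpecΓ_naturality, Category.assoc,
    toSpecΓ_SpecMap_ΓSpecIso_inv, Category.comp_id]

end Sections

/-! ## Packaging: an isomorphism `K ⊗_R B ≃ Γ(S)` makes `S` the base change of `Spec B → Spec R` -/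

section Packaging

variable {K : Type u} [CommRing K] (S : SchemeOver K) [IsAffine S.left]
  {R : Type u} [CommRing R] [Algebra R K] (B : Type u) [CommRing B] [Algebra R B]

/-- **`Spec (K ⊗_R B)` is the fibre product `Spec K ×_{Spec R} Spec B`** (Mathlib
`CommRingCat.isPushout_tensorProduct` and `Spec` of a pushout), in the orientation
`IsPullback (Spec (K ⊗ B) → Spec B) (Spec (K ⊗ B) → Spec K) (Spec B → Spec R) (Spec K → Spec R)`.
[cite: Hartshorne1977, Ch. II Thm. 3.3] -/
theorem isPullback_specMap_includeRight :
    IsPullback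
      (Spec.map (CommRingCat.ofHom
        (Algebra.TensorProduct.includeRight (R := R) (A := K) (B := B)).toRingHom))
      (Spec.map (CommRingCat.ofHom (algebraMap K (K ⊗[R] B))))
      (Spec.map (CommRingCat.ofHom (algebraMap R B)))
      (Spec.map (CommRingCat.ofHom (algebraMap R K))) := by
  have halg : (algebraMap K (K ⊗[R] B)) =
      (Algebra.TensorProduct.includeLeftRingHom : K →+* K ⊗[R] B) :=
    RingHom.ext fun k => rfl
  rw [halg]
  exact (isPullback_SpecMap_of_isPushout _ _ _ _ (CommRingCat.isPushout_tensorProduct R K B)).flip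

/-- **Packaging.** Let `S` be an affine `K`-scheme and `e : K ⊗_R B ≃ₐ[K] Γ(S, 𝒪_S)` an isomorphism
of `K`-algebras (for the structure map `K → Γ(S)`). Then `S → Spec K` is the base change of
`Spec B → Spec R` along `Spec K → Spec R`: there is `π : S → Spec B` with
`IsPullback π (S → Spec K) (Spec B → Spec R) (Spec K → Spec R)`. [cite: Hartshorne1977, Ch. II Thm. 3.3] -/
theorem isPullback_of_tensorProduct_algEquiv
    (e : K ⊗[R] B ≃+* Γ(S.left, ⊤))
    (he : ∀ k : K, e (algebraMap K (K ⊗[R] B) k) =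
      S.hom.appTop.hom ((Scheme.ΓSpecIso (CommRingCat.of K)).inv.hom k)) :
    ∃ π : S.left ⟶ Spec (.of B), IsPullback π S.hom (Spec.map (CommRingCat.ofHom (algebraMap R B)))
      (Spec.map (CommRingCat.ofHom (algebraMap R K))) := by
  -- the isomorphism `ε : S ≅ Spec (K ⊗ B)` over `Spec K`
  let ε : S.left ≅ Spec (.of (K ⊗[R] B)) :=
    S.left.isoSpec ≪≫ Scheme.Spec.mapIso (e.toCommRingCatIso).op
  have hεhom : ε.hom = S.left.isoSpec.hom ≫ Spec.map (CommRingCat.ofHom e.toRingHom) := rfl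
  have hε : ε.hom ≫ Spec.map (CommRingCat.ofHom (algebraMap K (K ⊗[R] B))) = S.hom := by
    rw [hεhom, Category.assoc, ← Spec.map_comp, ← CommRingCat.ofHom_comp]
    have hcomp : e.toRingHom.comp (algebraMap K (K ⊗[R] B)) =
        S.hom.appTop.hom.comp (Scheme.ΓSpecIso (CommRingCat.of K)).inv.hom :=
      RingHom.ext fun k => he k
    rw [hcomp]
    exact isoSpec_hom_comp_specMap_secAlgebraMap S
  have sq₁ : IsPullback ε.hom S.hom (Spec.map (CommRingCat.ofHom (algebraMap K (K ⊗[R] B))))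
      (𝟙 _) :=
    IsPullback.of_horiz_isIso ⟨by rw [hε, Category.comp_id]⟩
  have sq := sq₁.paste_horiz (isPullback_specMap_includeRight (K := K) (R := R) B)
  rw [Category.id_comp] at sq
  exact ⟨_, sq⟩

end Packaging


/-! ## The smooth affine model -/

section Model

/-- `Spec` of a ring isomorphism is an isomorphism. [folklore] -/
private theorem isIso_specMap_ringEquiv {A B : Type u} [CommRing A] [CommRing B] (e : A ≃+* B) :
    IsIso (Spec.map (CommRingCat.ofHom e.toRingHom)) := by
  change IsIso (Spec.map e.toCommRingCatIso.hom)
  infer_instance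

/-- `Spec` of an algebra isomorphism is an isomorphism. [folklore] -/
private theorem isIso_specMap_algEquiv {R A B : Type u} [CommRing R] [CommRing A] [CommRing B]
    [Algebra R A] [Algebra R B] (e : A ≃ₐ[R] B) :
    IsIso (Spec.map (CommRingCat.ofHom (e : A →ₐ[R] B).toRingHom)) := by
  have h : (e : A →ₐ[R] B).toRingHom = e.toRingEquiv.toRingHom := rfl
  rw [h]
  exact isIso_specMap_ringEquiv e.toRingEquiv

/-- Smoothness of `Spec (T ⊗_R A) → Spec T` from smoothness of the base change
`pullback.snd : Spec A ×_R Spec T → Spec T`, and conversely: the two differ by the isomorphism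
`Spec (A ⊗_R T) ≅ Spec A ×_{Spec R} Spec T` and the symmetry `A ⊗ T ≅ T ⊗ A`. [folklore] -/
private theorem smooth_specMap_algebraMap_tensor_iff {R A T : Type u} [CommRing R] [CommRing A]
    [CommRing T] [Algebra R A] [Algebra R T] :
    Smooth (Spec.map (CommRingCat.ofHom (algebraMap T (T ⊗[R] A)))) ↔
      Smooth (pullback.snd (Spec.map (CommRingCat.ofHom (algebraMap R A)))
        (Spec.map (CommRingCat.ofHom (algebraMap R T)))) := by
  have h1 : pullback.snd (Spec.map (CommRingCat.ofHom (algebraMap R A)))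
      (Spec.map (CommRingCat.ofHom (algebraMap R T))) =
      (pullbackSpecIso R A T).hom ≫ Spec.map (CommRingCat.ofHom
        (Algebra.TensorProduct.includeRight (R := R) (A := A) (B := T)).toRingHom) :=
    (pullbackSpecIso_hom_snd R A T).symm
  have h2 : (Algebra.TensorProduct.includeRight (R := R) (A := A) (B := T)).toRingHom =
      (Algebra.TensorProduct.comm R T A).toRingEquiv.toRingHom.comp (algebraMap T (T ⊗[R] A)) := by
    refine RingHom.ext fun t => ?_
    change (1 : A) ⊗ₜ[R] t = Algebra.TensorProduct.comm R T A (algebraMap T (T ⊗[R] A) t)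
    rw [Algebra.TensorProduct.algebraMap_apply, Algebra.algebraMap_self, RingHom.id_apply,
      Algebra.TensorProduct.comm_tmul]
  have key : pullback.snd (Spec.map (CommRingCat.ofHom (algebraMap R A)))
      (Spec.map (CommRingCat.ofHom (algebraMap R T))) =
      (pullbackSpecIso R A T).hom ≫
        Spec.map (CommRingCat.ofHom (Algebra.TensorProduct.comm R T A).toRingEquiv.toRingHom) ≫
          Spec.map (CommRingCat.ofHom (algebraMap T (T ⊗[R] A))) := by
    rw [← Spec.map_comp, ← CommRingCat.ofHom_comp, ← h2]
    exact h1
  haveI := isIso_specMap_ringEquiv (Algebra.TensorProduct.comm R T A).toRingEquiv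
  constructor
  · intro h
    rw [key, MorphismProperty.cancel_left_of_respectsIso (P := @Smooth),
      MorphismProperty.cancel_left_of_respectsIso (P := @Smooth)]
    exact h
  · intro h
    rw [key, MorphismProperty.cancel_left_of_respectsIso (P := @Smooth),
      MorphismProperty.cancel_left_of_respectsIso (P := @Smooth)] at h
    exact h

/-- **Step 1 — the finitely generated model of the coordinate ring.** For an integral affine
`K`-scheme `S` of finite type: a finitely generated subring `R₀ ⊆ K`, a finitely generated
`R₀`-domain `C₀ ⊇ R₀` and a ring isomorphism `K ⊗_{R₀} C₀ ≅ Γ(S, 𝒪_S)` compatible with the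
structure maps from `K`. [cite: EGAIV3, Thm. 8.8.2 (ii)] -/
theorem exists_fg_subalgebra_model_of_isAffine {K : Type u} [Field K] (S : SchemeOver K)
    [IsAffine S.left] [IsIntegral S.left] [LocallyOfFiniteType S.hom] :
    ∃ (R₀ : Subalgebra ℤ K) (C₀ : Type u) (_ : CommRing C₀) (_ : IsDomain C₀) (_ : Algebra R₀ C₀)
      (e₀ : K ⊗[R₀] C₀ ≃+* Γ(S.left, ⊤)),
      R₀.FG ∧ Algebra.FiniteType R₀ C₀ ∧ Function.Injective (algebraMap R₀ C₀) ∧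
      ∀ k : K, e₀ (algebraMap K (K ⊗[R₀] C₀) k) =
        S.hom.appTop.hom ((Scheme.ΓSpecIso (CommRingCat.of K)).inv.hom k) := by
  classical
  letI algKC : Algebra K Γ(S.left, ⊤) :=
    (S.hom.appTop.hom.comp (Scheme.ΓSpecIso (CommRingCat.of K)).inv.hom).toAlgebra
  haveI : Algebra.FiniteType K Γ(S.left, ⊤) := by
    have h1 : S.hom.appTop.hom.FiniteType :=
      (HasRingHomProperty.iff_of_isAffine (P := @LocallyOfFiniteType)).mp inferInstance
    have h2 : (Scheme.ΓSpecIso (CommRingCat.of K)).inv.hom.FiniteType :=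
      RingHom.FiniteType.of_surjective _
        (Scheme.ΓSpecIso (CommRingCat.of K)).symm.commRingCatIsoToRingEquiv.surjective
    exact h1.comp h2
  haveI : Nonempty (↑(⊤ : S.left.Opens) : Set S.left) := ⟨⟨genericPoint S.left, trivial⟩⟩
  haveI : IsDomain Γ(S.left, ⊤) := inferInstance
  obtain ⟨R₀, C₀, _, _, hR₀fg, hC₀ft, hdom, hinj, ⟨e₀⟩⟩ :=
    Literature.RingTheory.Localization.exists_fg_subalgebra_tensorProduct_algEquiv (K := K) Γ(S.left, ⊤)
  exact ⟨R₀, C₀, inferInstance, hdom inferInstance, inferInstance, e₀.toRingEquiv, hR₀fg, hC₀ft,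
    hinj inferInstance, fun k => e₀.commutes k⟩

/-- **Step 2 — descent of smoothness along a field extension of the base.** For a tower of rings
`R₀ → F → K` with `F`, `K` fields: if `Spec (K ⊗_{R₀} C₀) → Spec K` is smooth then so is
`Spec (F ⊗_{R₀} C₀) → Spec F` (fpqc descent along `Spec K → Spec F`; the square
`Spec (K ⊗ C₀) → Spec (F ⊗ C₀)` over `Spec K → Spec F` is cartesian because both are base changes
of `Spec C₀ → Spec R₀`). [cite: EGAIV4, Prop. 17.7.4 (vi)⇒(i)] -/
theorem smooth_specMap_tensor_of_smooth_fieldExt {R₀ F K : Type u} [CommRing R₀] [Field F]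
    [Field K] [Algebra R₀ F] [Algebra R₀ K] [Algebra F K] [IsScalarTower R₀ F K]
    (C₀ : Type u) [CommRing C₀] [Algebra R₀ C₀]
    (h : Smooth (Spec.map (CommRingCat.ofHom (algebraMap K (K ⊗[R₀] C₀))))) :
    Smooth (Spec.map (CommRingCat.ofHom (algebraMap F (F ⊗[R₀] C₀)))) := by
  classical
  -- the comparison map `F ⊗ C₀ → K ⊗ C₀`
  let m : F ⊗[R₀] C₀ →ₐ[R₀] K ⊗[R₀] C₀ :=
    Algebra.TensorProduct.map (IsScalarTower.toAlgHom R₀ F K) (AlgHom.id R₀ C₀)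
  have hm : ∀ (f : F) (c : C₀), m (f ⊗ₜ[R₀] c) = algebraMap F K f ⊗ₜ[R₀] c := fun f c =>
    Algebra.TensorProduct.map_tmul _ _ f c
  have hm₁ : m.toRingHom.comp
      (Algebra.TensorProduct.includeRight (R := R₀) (A := F) (B := C₀)).toRingHom =
      (Algebra.TensorProduct.includeRight (R := R₀) (A := K) (B := C₀)).toRingHom := by
    refine RingHom.ext fun c => ?_
    change m ((1 : F) ⊗ₜ[R₀] c) = (1 : K) ⊗ₜ[R₀] c
    rw [hm, map_one]
  have hm₂ : m.toRingHom.comp (algebraMap F (F ⊗[R₀] C₀)) =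
      (algebraMap K (K ⊗[R₀] C₀)).comp (algebraMap F K) := by
    refine RingHom.ext fun f => ?_
    change m (algebraMap F (F ⊗[R₀] C₀) f) = algebraMap K (K ⊗[R₀] C₀) (algebraMap F K f)
    rw [Algebra.TensorProduct.algebraMap_apply, Algebra.algebraMap_self, RingHom.id_apply,
      Algebra.TensorProduct.algebraMap_apply, Algebra.algebraMap_self, RingHom.id_apply, hm]
  have hFK : (algebraMap F K).comp (algebraMap R₀ F) = algebraMap R₀ K :=
    (IsScalarTower.algebraMap_eq R₀ F K).symm
  -- the outer rectangle `Spec (K ⊗ C₀) → Spec C₀` over `Spec K → Spec R₀`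
  have big : IsPullback
      (Spec.map (CommRingCat.ofHom m.toRingHom) ≫ Spec.map (CommRingCat.ofHom
        (Algebra.TensorProduct.includeRight (R := R₀) (A := F) (B := C₀)).toRingHom))
      (Spec.map (CommRingCat.ofHom (algebraMap K (K ⊗[R₀] C₀))))
      (Spec.map (CommRingCat.ofHom (algebraMap R₀ C₀)))
      (Spec.map (CommRingCat.ofHom (algebraMap F K)) ≫
        Spec.map (CommRingCat.ofHom (algebraMap R₀ F))) := by
    rw [← Spec.map_comp, ← Spec.map_comp, ← CommRingCat.ofHom_comp, ← CommRingCat.ofHom_comp,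
      hm₁, hFK]
    exact isPullback_specMap_includeRight (K := K) (R := R₀) C₀
  -- the right square `Spec (F ⊗ C₀) → Spec C₀` over `Spec F → Spec R₀`
  have right := isPullback_specMap_includeRight (K := F) (R := R₀) C₀
  -- hence the left square is cartesian
  have comm : Spec.map (CommRingCat.ofHom m.toRingHom) ≫
      Spec.map (CommRingCat.ofHom (algebraMap F (F ⊗[R₀] C₀))) =
      Spec.map (CommRingCat.ofHom (algebraMap K (K ⊗[R₀] C₀))) ≫
        Spec.map (CommRingCat.ofHom (algebraMap F K)) := by
    rw [← Spec.map_comp, ← Spec.map_comp, ← CommRingCat.ofHom_comp, ← CommRingCat.ofHom_comp, hm₂]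
  have left := IsPullback.of_right big comm right
  -- descent along `Spec K → Spec F`
  exact MorphismProperty.of_isPullback_of_descendsAlong (P := @Smooth)
    (Q := @Surjective ⊓ @Flat ⊓ @QuasiCompact) left.flip (ProperDescent.fpqc_specMap F K) h

/-- **Step 3 — spreading out smoothness** (EGA IV₄ 17.7.8 (ii) through
`LocApprox.exists_forall_smooth_snd`): if `Spec C₀ → Spec R₀` (`R₀` a Noetherian domain with
fraction field `F`, `C₀` of finite type) has smooth generic fibre `Spec (F ⊗ C₀) → Spec F`, then for
some `s ≠ 0` and every model `T` of `R₀[1/s]`, `Spec (T ⊗ C₀) → Spec T` is smooth; if moreover `C₀`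
is a domain containing `R₀`, then `T ⊗_{R₀} C₀ = C₀[1/s]` is a domain. [cite: EGAIV4, Prop. 17.7.8 (ii)] -/
theorem exists_forall_away_smooth_specMap_tensor {R₀ : Type u} [CommRing R₀] [IsDomain R₀]
    [IsNoetherianRing R₀] (C₀ : Type u) [CommRing C₀] [IsDomain C₀] [Algebra R₀ C₀]
    (hft : Algebra.FiniteType R₀ C₀) (hinj : Function.Injective (algebraMap R₀ C₀))
    (F : Type u) [Field F] [Algebra R₀ F] [IsFractionRing R₀ F]
    (hsm : Smooth (Spec.map (CommRingCat.ofHom (algebraMap F (F ⊗[R₀] C₀))))) :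
    ∃ s : R₀, s ≠ 0 ∧ ∀ (T : Type u) [CommRing T] [Algebra R₀ T] [IsLocalization.Away s T],
      Smooth (Spec.map (CommRingCat.ofHom (algebraMap T (T ⊗[R₀] C₀)))) ∧
      IsDomain (T ⊗[R₀] C₀) := by
  classical
  let P : SchemeOver R₀ := Over.mk (Spec.map (CommRingCat.ofHom (algebraMap R₀ C₀)))
  have hlfp : LocallyOfFinitePresentation (Spec.map (CommRingCat.ofHom (algebraMap R₀ C₀))) := by
    rw [HasRingHomProperty.Spec_iff (P := @LocallyOfFinitePresentation)]
    exact RingHom.FinitePresentation.of_finiteType.mp (RingHom.finiteType_algebraMap.mpr hft)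
  haveI : LocallyOfFinitePresentation P.hom := hlfp
  have hqc : QuasiCompact (Spec.map (CommRingCat.ofHom (algebraMap R₀ C₀))) := inferInstance
  haveI : QuasiCompact P.hom := hqc
  have hgen : Smooth (pullback.snd P.hom (Spec.map (CommRingCat.ofHom (algebraMap R₀ F)))) := by
    have h' := smooth_specMap_algebraMap_tensor_iff.mp hsm
    exact h'
  obtain ⟨s₁, hs₁, H₁⟩ := LocApprox.exists_forall_smooth_snd (nonZeroDivisors R₀) F P hgen
  have hs₁0 : s₁ ≠ 0 := nonZeroDivisors.ne_zero hs₁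
  refine ⟨s₁, hs₁0, fun T _ _ _ => ⟨?_, ?_⟩⟩
  · have h' : Smooth (pullback.snd (Spec.map (CommRingCat.ofHom (algebraMap R₀ C₀)))
        (Spec.map (CommRingCat.ofHom (algebraMap R₀ T)))) := H₁ s₁ dvd_rfl T
    exact smooth_specMap_algebraMap_tensor_iff.mpr h'
  · letI : Algebra C₀ (T ⊗[R₀] C₀) := Algebra.TensorProduct.rightAlgebra
    haveI : IsLocalization (Algebra.algebraMapSubmonoid C₀ (Submonoid.powers s₁)) (T ⊗[R₀] C₀) :=
      IsLocalization.tensorRight (R := R₀) (S := C₀) T (Submonoid.powers s₁)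
    refine IsLocalization.isDomain_of_le_nonZeroDivisors (T ⊗[R₀] C₀)
      (M := Algebra.algebraMapSubmonoid C₀ (Submonoid.powers s₁)) ?_
    rw [Algebra.algebraMapSubmonoid, Submonoid.map_powers]
    refine powers_le_nonZeroDivisors_of_noZeroDivisors ?_
    rw [Ne, ← map_zero (algebraMap R₀ C₀), hinj.eq_iff]
    exact hs₁0

/-- **Steps 2–5 assembled over an abstract model**: given the affine `K`-scheme `S`, smooth of
relative dimension `d`, as `Γ(S) ≅ K ⊗_{R₀} C₀` for a Noetherian domain `R₀ ⊆ K` and a finitely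
generated domain `C₀ ⊇ R₀`, there is `s ≠ 0` in `R₀` such that for every model `T` of `R₀[1/s]`
inside `K`, `Spec (T ⊗ C₀) → Spec T` is smooth of relative dimension `d` and `S` is its base change
along `Spec K → Spec T`. [cite: EGAIV4, Prop. 17.7.8 (ii)] -/
theorem exists_forall_away_smooth_model {K : Type u} [Field K] {d : ℕ} (S : SchemeOver K)
    [IsAffine S.left] [Nonempty S.left] [SmoothOfRelativeDimension d S.hom]
    {R₀ : Type u} [CommRing R₀] [IsDomain R₀] [IsNoetherianRing R₀] [Algebra R₀ K]
    (hRK : Function.Injective (algebraMap R₀ K))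
    (C₀ : Type u) [CommRing C₀] [IsDomain C₀] [Algebra R₀ C₀] (hft : Algebra.FiniteType R₀ C₀)
    (hinj : Function.Injective (algebraMap R₀ C₀))
    (e₀ : K ⊗[R₀] C₀ ≃+* Γ(S.left, ⊤))
    (he₀ : ∀ k : K, e₀ (algebraMap K (K ⊗[R₀] C₀) k) =
      S.hom.appTop.hom ((Scheme.ΓSpecIso (CommRingCat.of K)).inv.hom k)) :
    ∃ s : R₀, s ≠ 0 ∧ ∀ (T : Type u) [CommRing T] [Algebra R₀ T] [IsLocalization.Away s T]
      [Algebra T K] [IsScalarTower R₀ T K],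
      ∃ (B : Type u) (_ : CommRing B) (_ : Algebra T B) (_ : Algebra.FiniteType T B)
        (π : S.left ⟶ Spec (.of B)),
        SmoothOfRelativeDimension d (Spec.map (CommRingCat.ofHom (algebraMap T B))) ∧
        IsPullback π S.hom (Spec.map (CommRingCat.ofHom (algebraMap T B)))
          (Spec.map (CommRingCat.ofHom (algebraMap T K))) := by
  classical
  haveI : Smooth S.hom := SmoothOfRelativeDimension.smooth d S.hom
  -- `Spec (K ⊗ C₀) → Spec K` is smooth: it is another pullback of the cospan of `S`
  obtain ⟨π₀, sq₀⟩ := isPullback_of_tensorProduct_algEquiv S C₀ e₀ he₀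
  have hsmK : Smooth (Spec.map (CommRingCat.ofHom (algebraMap K (K ⊗[R₀] C₀)))) := by
    have sqT := isPullback_specMap_includeRight (K := K) (R := R₀) C₀
    have hi : (sq₀.isoIsPullback _ _ sqT).hom ≫
        Spec.map (CommRingCat.ofHom (algebraMap K (K ⊗[R₀] C₀))) = S.hom :=
      sq₀.isoIsPullback_hom_snd _ _ sqT
    have : Spec.map (CommRingCat.ofHom (algebraMap K (K ⊗[R₀] C₀))) =
        (sq₀.isoIsPullback _ _ sqT).inv ≫ S.hom := (Iso.eq_inv_comp _).2 hi
    rw [this, MorphismProperty.cancel_left_of_respectsIso (P := @Smooth)]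
    infer_instance
  -- the fraction field inside `K`, descent, spreading out
  let ψ : FractionRing R₀ →+* K := IsFractionRing.lift (g := algebraMap R₀ K) hRK
  letI algFK : Algebra (FractionRing R₀) K := ψ.toAlgebra
  haveI : IsScalarTower R₀ (FractionRing R₀) K := IsScalarTower.of_algebraMap_eq fun r =>
    (IsFractionRing.lift_algebraMap (g := algebraMap R₀ K) hRK r).symm
  have hsmF := smooth_specMap_tensor_of_smooth_fieldExt (F := FractionRing R₀) C₀ hsmK
  obtain ⟨s₁, hs₁0, H⟩ := exists_forall_away_smooth_specMap_tensor C₀ hft hinj (FractionRing R₀) hsmF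
  refine ⟨s₁, hs₁0, fun T _ _ _ _ _ => ?_⟩
  obtain ⟨hsmT, hdomT⟩ := H T
  haveI := hdomT
  -- the cartesian square for `T`
  let cb := Algebra.TensorProduct.cancelBaseChange R₀ T K K C₀
  have hcb : ∀ k : K, cb.toRingEquiv (algebraMap K (K ⊗[T] (T ⊗[R₀] C₀)) k) =
      algebraMap K (K ⊗[R₀] C₀) k := fun k => cb.commutes k
  obtain ⟨π, sq⟩ := isPullback_of_tensorProduct_algEquiv S (T ⊗[R₀] C₀)
    (cb.toRingEquiv.trans e₀) (fun k => by rw [RingEquiv.trans_apply, hcb, he₀])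
  -- the relative dimension is `d`
  haveI : Smooth (Spec.map (CommRingCat.ofHom (algebraMap T (T ⊗[R₀] C₀)))) := hsmT
  obtain ⟨d', hd'⟩ := exists_smoothOfRelativeDimension_of_smooth
    (Spec.map (CommRingCat.ofHom (algebraMap T (T ⊗[R₀] C₀))))
  haveI := smoothOfRelativeDimension_isStableUnderBaseChange (n := d')
  have hd'S : SmoothOfRelativeDimension d' S.hom := MorphismProperty.of_isPullback sq hd'
  obtain rfl : d = d' :=
    AbelianVarietyProofs.eq_of_smoothOfRelativeDimension S.hom ‹SmoothOfRelativeDimension d S.hom› hd'S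
  haveI : Algebra.FiniteType R₀ C₀ := hft
  have hBft : Algebra.FiniteType T (T ⊗[R₀] C₀) := inferInstance
  exact ⟨T ⊗[R₀] C₀, inferInstance, inferInstance, hBft, π, hd', sq⟩

/-- **A smooth integral affine scheme over a field has a smooth affine model over a ring of finite
type over `ℤ`** (EGA IV₃ 8.8.2 (ii), 8.10.5; IV₄ 17.7.8 (ii) — the "spreading out over a finitely
generated `ℤ`-algebra" of Maulik–Poonen 2012, §4, for an affine variety). For `S` affine, integral and
smooth of relative dimension `d` over a field `K` there are a ring `R` of finite type over `ℤ` with a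
ring map `R → K` (`Algebra R K`; injectivity is not recorded, see the module docstring), an
`R`-algebra `B` of finite type with `Spec B → Spec R` smooth of relative dimension `d`, and
`π : S → Spec B` with `IsPullback π (S → Spec K) (Spec B → Spec R) (Spec K → Spec R)`.
[cite: EGAIV4, Prop. 17.7.8 (ii)] [cite: MaulikPoonen2012, §4] -/
theorem exists_smooth_affine_model_finiteType_int {K : Type u} [Field K] {d : ℕ}
    (S : SchemeOver K) [IsAffine S.left] [IsIntegral S.left] [SmoothOfRelativeDimension d S.hom] :
    ∃ (R : Type u) (_ : CommRing R) (_ : Algebra R K) (_ : Algebra.FiniteType ℤ R)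
      (B : Type u) (_ : CommRing B) (_ : Algebra R B) (_ : Algebra.FiniteType R B)
      (π : S.left ⟶ Spec (.of B)),
      SmoothOfRelativeDimension d (Spec.map (CommRingCat.ofHom (algebraMap R B))) ∧
      IsPullback π S.hom (Spec.map (CommRingCat.ofHom (algebraMap R B)))
        (Spec.map (CommRingCat.ofHom (algebraMap R K))) := by
  classical
  haveI : Smooth S.hom := SmoothOfRelativeDimension.smooth d S.hom
  -- 1. the model of the coordinate ring
  obtain ⟨R₀, C₀, _, _, _, e₀, hR₀fg, hC₀ft, hinj₀, he₀⟩ := exists_fg_subalgebra_model_of_isAffine S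
  haveI : Algebra.FiniteType ℤ R₀ := (Subalgebra.fg_iff_finiteType _).mp hR₀fg
  haveI : IsNoetherianRing R₀ := Algebra.FiniteType.isNoetherianRing ℤ R₀
  -- 2.–5. spreading out
  obtain ⟨s₁, hs₁0, H⟩ := exists_forall_away_smooth_model (d := d) S (R₀ := (R₀ : Type u))
    Subtype.val_injective C₀ hC₀ft hinj₀ e₀ he₀
  -- `K` as an `R₀[1/s]`-algebra
  have hunit : IsUnit (algebraMap R₀ K s₁) := Ne.isUnit fun h => hs₁0 (Subtype.ext h)
  letI algRK : Algebra (Localization.Away s₁) K := (IsLocalization.Away.lift s₁ hunit).toAlgebra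
  haveI : IsScalarTower (R₀ : Type u) (Localization.Away s₁) K :=
    IsScalarTower.of_algebraMap_eq fun r ↦ (IsLocalization.Away.lift_eq s₁ hunit r).symm
  obtain ⟨B, _, _, hBft, π, hd, sq⟩ := H (Localization.Away s₁)
  -- finite type bookkeeping
  haveI : Algebra.FinitePresentation (R₀ : Type u) (Localization.Away s₁) :=
    IsLocalization.Away.finitePresentation s₁
  have hRft : Algebra.FiniteType ℤ (Localization.Away s₁) :=
    Algebra.FiniteType.trans (inferInstance : Algebra.FiniteType ℤ R₀) inferInstance
  have hRft' : @Algebra.FiniteType ℤ (Localization.Away s₁) _ _ (Ring.toIntAlgebra _) := by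
    have h : (Ring.toIntAlgebra (Localization.Away s₁) : Algebra ℤ (Localization.Away s₁)) =
        OreLocalization.instAlgebra := Subsingleton.elim _ _
    rw [h]; exact hRft
  exact ⟨Localization.Away s₁, inferInstance, algRK, hRft', B, ‹_›, ‹_›, hBft, π, hd, sq⟩

end Model

end Literature.AlgebraicGeometry.Limits

end
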